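import Summits.BirchSwinnertonDyer.BirchSwinnertonDyer.Theorems.ErratumRoadFiveErratumThm23SelfDualOfTwoVarCoreLocalDefect
import Summits.BirchSwinnertonDyer.BirchSwinnertonDyer.Theorems.ErratumRoadFiveFixedPartOfThm326SelfDual
import HarnessLib

/-!
# Crux `ErratumThm23SigmaLeSelfDual` (stmt-BirchSwinnertonDyer-23253) FROM THE OPEN TWO-VARIABLE CORE S1† AND THE PRINTED THEOREM
# [Wiles 1988 Thm 2.2] ALONE — the whole S2 side of line `erratum_chain`† is kernel-checked (helper, `--supports stmt-BirchSwinnertonDyer-23253`)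

Cell `bsd-stepL`, seat `bsd-stepL-imc-p1` (prover g25, 2026-08-28). Theorems only (no definition, no named fact, no `sorry`, no instance,
no notation). One-line composition of the two tree theorems
`ErratumChainSelfDual.erratumThm23SigmaLeSelfDual_of_twoVarCore_of_localDefect` (p665011: descent + control + finite local defect ⟹ crux†,
BY NAME) and `FixFinalSelfDual.stub_localDefectFiniteAnomalous_selfDual_of_thm326` (p670492: S2♭♭† ⟸ (FIX)† ⟸ [W]). This is the
twisted analogue of the state imc-p1 g23 reached for the history item 25505 (`erratum_chain` v7 proposal):

    ErratumThm23SigmaLeSelfDual  ⟸  stub_FW21_twoVarSigmaLePinned_selfDual (S1†, OPEN∕PRE: [FW21 Thm 4.41] at the twist)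
                                     +  Hida2000_thm326_ordinary_unitRoot (named fact = printed theorem [Wiles88 Thm 2.2 ∕ Hida00 Thm 3.26 (2)]).

* `erratumThm23SigmaLeSelfDual_of_twoVarCore_of_thm326` — the statement, concluding the route decl BY NAME.

HONEST FRAMING: CONDITIONAL on S1† (OPEN, unrefereed [FW21] + the unprinted weight-`k` CGS computation) and on the named fact [W]; no
summit statement is proved; the crux is concluded only under these two displayed hypotheses; BSD is proved for no pair; closes: none (T7).

[claim: FouquetWan2021, Thm. 4.41, App. B Cor. 7.21, Lemma 7.22, status: under-review] [claim: Castella2018Erratum, Thm. 2.3, status: under-review]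
[cite: JetchevSkinnerWan2017, §3.4, Lemma 3.4.1, Cor. 3.4.2] [cite: Wiles1988, Thm. 2.2] [cite: Castella2018Erratum, §2 (p. 2), Lemma 2.1]
-/

noncomputable section

-- D-0017: single-problem summit, the namespace repeats the problem name by design.
set_option linter.dupNamespace false
set_option autoImplicit false

open scoped Classical

open PowerSeries NumberField IsDedekindDomain Field
  Literature.NumberTheory.EllipticCurves Literature.NumberTheory.EllipticCurves.ModularForms
  Literature.NumberTheory.EllipticCurves.BigGaloisRep Literature.NumberTheory.EllipticCurves.GreenbergSelmer
  Literature.NumberTheory.GaloisRepresentations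

namespace Summit.BirchSwinnertonDyer.BirchSwinnertonDyer.Theorems.ErratumThm23TwoVariable.ErratumChainSelfDual

set_option maxHeartbeats 400000 in
/-- **Crux† ⟸ S1† + [Wiles 1988 Thm 2.2].** `hFW` = the stub `stub_FW21_twoVarSigmaLePinned_selfDual` of line `erratum_chain`† VERBATIM
(the OPEN two-variable core at the self-dual twist); `hW` = the named fact `Hida2000_thm326_ordinary_unitRoot`; conclusion = the route decl
`Theses.ErratumRoadFive.ErratumThm23SigmaLeSelfDual` BY NAME. [cite: Castella2018Erratum, proof of Thm. 2.3: (2.4) ⇒ (2.5) (p. 4)]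
[cite: JetchevSkinnerWan2017, §3.4, Lemma 3.4.1, Cor. 3.4.2 (arXiv:1512.06894 p. 14)] [cite: Wiles1988, Thm. 2.2] -/
theorem erratumThm23SigmaLeSelfDual_of_twoVarCore_of_thm326
    (hFW :
    ∀ {p : ℕ} [Fact p.Prime] (ι : PadicAlgCl p ≃+* ℂ) {M : ℕ} [NeZero M] {k : ℤ}
      (g : CuspForm (CongruenceSubgroup.Gamma0 M) k) (ιg : coeffField g →+* PadicAlgCl p)
      (Δ : OrdinaryNewformDatum g p ιg)
      (K : Type) [Field K] [NumberField K] (𝔭 𝔭bar : HeightOneSpectrum (𝓞 K)) (κ : ZpExtension K p)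
      (γ : absoluteGaloisGroup K) [Fact (κ.IsTopGenerator γ)] (S : Finset (HeightOneSpectrum (𝓞 K))),
      IsNewform0 g → 2 ≤ k → Even k → 3 ≤ M → ¬ p ∣ M → 3 < p →
      (∀ x : coeffField g, ι (ιg x) = (x : ℂ)) →
      ‖ιg ⟨(UpperHalfPlane.qExpansion 1 ⇑g).coeff p, coeff_mem_coeffField g p⟩‖ = 1 →
      IsImaginaryQuadratic K → (∃ β : ℤ, (4 * M : ℤ) ∣ β ^ 2 - NumberField.discr K) →
      ((Ideal.span {(p : ℤ)}).primesOver (𝓞 K)).ncard = 2 →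
      ((p : ℕ) : 𝓞 K) ∈ 𝔭.asIdeal →
      (∀ (w : InfinitePlace K) (x : 𝓞 K), x ∈ 𝔭.asIdeal ↔ ‖ι.symm (w.embedding (x : K))‖ < 1) →
      ((p : ℕ) : 𝓞 K) ∈ 𝔭bar.asIdeal → 𝔭bar ≠ 𝔭 →
      SkinnerUrban2014.IsResiduallyIrreducible Δ →
      (∃ v : HeightOneSpectrum (𝓞 ℚ), SkinnerUrban2014.IsResiduallyRamifiedAt Δ v ∧
        ((Rat.HeightOneSpectrum.primesEquiv v : Nat.Primes) : ℕ) ∣ M ∧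
        ¬ ((Rat.HeightOneSpectrum.primesEquiv v : Nat.Primes) : ℕ) ^ 2 ∣ M ∧
        ((Ideal.span {(((Rat.HeightOneSpectrum.primesEquiv v : Nat.Primes) : ℕ) : ℤ)}).primesOver (𝓞 K)).ncard ≠ 2) →
      (((Ideal.span {(2 : ℤ)}).primesOver (𝓞 K)).ncard ≠ 2 → (2 ∣ M ∧ ¬ 4 ∣ M)) →
      (∀ ℓ : ℕ, ℓ.Prime → ℓ ∣ M → ((Ideal.span {(ℓ : ℤ)}).primesOver (𝓞 K)).ncard ≠ 2 →
        ¬ ℓ ^ 2 ∣ M ∧ (UpperHalfPlane.qExpansion 1 ⇑g).coeff ℓ = -((ℓ : ℂ) ^ (k / 2 - 1).toNat)) →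
      κ.IsAnticyclotomic → (∀ w ∈ S, ((p : ℕ) : 𝓞 K) ∉ w.asIdeal) →
      (∀ w : HeightOneSpectrum (𝓞 K), ((M : ℕ) : 𝓞 K) ∈ w.asIdeal → w ∈ S) →
      ∀ (b : padicCoeffIntegers ιg →+* PadicComplexInt p),
        (∀ x, ((b x : PadicComplexInt p) : ℂ_[p]) =
          algebraMap (PadicAlgCl p) ℂ_[p] (padicCoeffIntegers.toPadicAlgCl ιg x)) →
      ∀ (ΩK : ℂ) (Ωp : (PadicComplexInt p)ˣ) (Q : PowerSeries (PadicComplexInt p)), ΩK ≠ 0 →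
        IsBDPLFunctionWtSigmaInt ι 𝔭 κ γ g S ΩK ((Ωp : PadicComplexInt p) : ℂ_[p]) Q →
      -- the complementary (cyclotomic) direction `κ'` with generator `γ'`: `Γ_K = Γ⁺ ⊕ Γ⁻ ≅ ℤ_p²` for `p` odd
      ∀ (κ' : ZpExtension K p) (γ' : absoluteGaloisGroup K) [Fact (κ'.IsTopGenerator γ')], κ'.IsCyclotomic →
      ∀ [TopologicalSpace (PowerSeries (padicCoeffIntegers ιg))]
        [TopologicalSpace (PowerSeries (PowerSeries (padicCoeffIntegers ιg)))]
        [ContinuousSMul (PowerSeries (PowerSeries (padicCoeffIntegers ιg)))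
          (BigRepModule (PowerSeries (padicCoeffIntegers ιg)) p
            (BigRepModule (padicCoeffIntegers ιg) p (Cofree Δ.selfDualRep (padicCoeffField ιg))))],
      -- premise: `X^Σ_K(A_g)` is `Λ_K`-torsion; conclusion: a two-variable frame pinned to `Q` on `X = 0` dividing `Ch_{Λ_K}(X^Σ_K(A_g))`
      Module.IsTorsion (PowerSeries (PowerSeries (padicCoeffIntegers ιg)))
          (XBig κ' (AnticyclotomicBigGaloisRep κ (Δ.selfDualCofreeRepOver K)) 𝔭bar (↑S)) →
      ∃ Q₂ : PowerSeries (PowerSeries (PadicComplexInt p)),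
        (∃ u : (PowerSeries (PadicComplexInt p))ˣ,
            PowerSeries.constantCoeff Q₂ = (u : PowerSeries (PadicComplexInt p)) * Q) ∧
        (XBig.charIdeal κ' (AnticyclotomicBigGaloisRep κ (Δ.selfDualCofreeRepOver K)) 𝔭bar (↑S)).map
            (PowerSeries.map (PowerSeries.map b)) ≤ Ideal.span {Q₂} )
    (hW : Literature.NumberTheory.EllipticCurves.Hida2000_thm326_ordinary_unitRoot) :
    Summit.BirchSwinnertonDyer.BirchSwinnertonDyer.Theses.ErratumRoadFive.ErratumThm23SigmaLeSelfDual :=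
  erratumThm23SigmaLeSelfDual_of_twoVarCore_of_localDefect hFW
    (FixFinalSelfDual.stub_localDefectFiniteAnomalous_selfDual_of_thm326 hW)

end Summit.BirchSwinnertonDyer.BirchSwinnertonDyer.Theorems.ErratumThm23TwoVariable.ErratumChainSelfDual

end
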